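import Summits.ValiantsHypothesis.ValiantsHypothesis.Theorems.KPlusLogSqLawSymmetricDesigns

/-!
# Tropical census, symmetric designs — the transpose-ORBIT carrier model: vocabulary, the two row predicates, and exchange rule R1w

HONEST FRAMING.  Object-search cell `pub-symmetroid` (Valiant); helper vocabulary for the tropical layer of the OPEN item `WeakLifting`
(stmt-ValiantsHypothesis-19561) / the (3,4) symmetric tropical row (lift-p2 g4's `tropRow_three_four_symm_le`, p459728).  Typed VERBATIM from
the theory seat's farm-checked sketch `HOME/theory/g23/lean/OrbitDominanceSketch_g23.lean` (theory g23, 2026-08-26, method memo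
`HOME/theory/g23/method/TSYM34-METHOD-g23.md` §3–§4; namespace `.OrbitSketchG23` renamed `.Orbit`).  It is the BASE layer of the port plan
«T^orb_sym(3,4) ≤ 17 ∀ d» (memo §4 (a)–(d); typist of record: the val-sym-lift-p2 lineage): the transpose-orbit carrier model of SYMMETRIC tree
tropical designs (the cell's «5-type / patchwork» model of COMBO-BOUND-t2, theory-2 g4) next to the tree's single-term model (`IsDominant`), the
two row predicates with the inclusion of models, the two port TARGETS as named `Prop`s (NOT asserted), and ONE of the eight pairwise exchange
rules (R1w) kernel-checked in its exchange form for general `m`, `K` and integer slopes — no sweep object, no strictness, no adjacency.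

Nothing here is a census numeral or a claim: ζ_sym(3,4) ∈ {18,19} and DoorA34 = `PosRootLawAt 3 4 18` (stmt-ValiantsHypothesis-19980) are
untouched; `TSymOrb34Le17` / `TSymOrb34Le16` are port TARGETS (the cell holds «≤ 16 ∀ d» at two codes, COMBO-BOUND T34-16; «≤ 17 ∀ d» has the
pairwise-rule certificate of the method memo at one code), not theorems; nothing on `MatrixDescartes` (stmt-ValiantsHypothesis-18050) / `VP ≠ VNP`.
-/

-- `Summit.ValiantsHypothesis.ValiantsHypothesis.…` is the tree's mandated single-conjunct layout (Sub = Summit).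
set_option linter.dupNamespace false

namespace Summit.ValiantsHypothesis.ValiantsHypothesis.Theorems.LacunarySymmetroidMatrixDescartes.TropicalCensus.Orbit

open Summit.ValiantsHypothesis.ValiantsHypothesis.Theorems.MatrixDescartes.Negative
open Summit.ValiantsHypothesis.ValiantsHypothesis.Theorems.LacunarySymmetroidMatrixDescartes
open Summit.ValiantsHypothesis.ValiantsHypothesis.Theorems.LacunarySymmetroidMatrixDescartes.TropicalCensus
open scoped BigOperators

variable {m K : ℕ}

/-- The transposed Leibniz term `(σ⁻¹, λ ∘ σ⁻¹)` (same weight and sign for a symmetric design: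
`tropWeight_transpose`, `termSign_transpose`). [definition of the cell] -/
def transposeTerm (p : Equiv.Perm (Fin m) × (Fin m → Fin K)) : Equiv.Perm (Fin m) × (Fin m → Fin K) :=
  (p.1⁻¹, fun j => p.2 (p.1⁻¹ j))

/-- ORBIT-dominance: the term is present and beats every present term OUTSIDE its transpose orbit `{p, pᵀ}`.
(For a symmetric design `p` and `pᵀ` tie with equal sign, so the orbit patchworks with coefficient ±1 or ±2.) [definition of the cell] -/
def IsOrbitDominant (d : Fin K → ℕ) (v ε : Fin m → Fin m → Fin K → ℤ) (θ : ℤ)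
    (p : Equiv.Perm (Fin m) × (Fin m → Fin K)) : Prop :=
  termSign ε p ≠ 0 ∧
    ∀ p', p' ≠ p → p' ≠ transposeTerm p → termSign ε p' ≠ 0 → tropWeight d v θ p' < tropWeight d v θ p

/-- A uniquely dominant term is orbit-dominant (the single-term model sits inside the orbit model). [folklore] -/
theorem isOrbitDominant_of_isDominant (d : Fin K → ℕ) (v ε : Fin m → Fin m → Fin K → ℤ) (θ : ℤ)
    (p : Equiv.Perm (Fin m) × (Fin m → Fin K)) (h : IsDominant d v ε θ p) : IsOrbitDominant d v ε θ p :=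
  ⟨h.1, fun p' hne _ hs => h.2 p' hne hs⟩

/-- The SINGLE-TERM tropical row predicate restricted to symmetric designs (the shape of lift-p2 g4's
`tropRow_three_four_symm_le`, p459728: `TropRootLawAtSymm 3 4 18`). [definition of the cell] -/
def TropRootLawAtSymm (m K B : ℕ) : Prop :=
  ∀ (d : Fin K → ℕ) (v ε : Fin m → Fin m → Fin K → ℤ), (∀ i j l, v i j l = v j i l) → (∀ i j l, ε i j l = ε j i l) →
    ∀ (n : ℕ) (θ : Fin (n + 1) → ℤ) (p : Fin (n + 1) → Equiv.Perm (Fin m) × (Fin m → Fin K)),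
      StrictMono θ → (∀ k, IsDominant d v ε (θ k) (p k)) →
      (∀ k : Fin n, termSign ε (p k.castSucc) * termSign ε (p k.succ) < 0) → n ≤ B

/-- The ORBIT-MODEL tropical row predicate for symmetric designs: chains of orbit-dominant terms at strictly
increasing integer slopes with alternating signs have at most `B` sign changes. [definition of the cell] -/
def TropRootLawAtSymmOrb (m K B : ℕ) : Prop :=
  ∀ (d : Fin K → ℕ) (v ε : Fin m → Fin m → Fin K → ℤ), (∀ i j l, v i j l = v j i l) → (∀ i j l, ε i j l = ε j i l) →
    ∀ (n : ℕ) (θ : Fin (n + 1) → ℤ) (p : Fin (n + 1) → Equiv.Perm (Fin m) × (Fin m → Fin K)),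
      StrictMono θ → (∀ k, IsOrbitDominant d v ε (θ k) (p k)) →
      (∀ k : Fin n, termSign ε (p k.castSucc) * termSign ε (p k.succ) < 0) → n ≤ B

/-- Orbit-model row ⇒ single-term row (inclusion of models). [folklore] -/
theorem tropRootLawAtSymm_of_orb {m K B : ℕ} (h : TropRootLawAtSymmOrb m K B) : TropRootLawAtSymm m K B :=
  fun d v ε hv hε n θ p hθ hdom halt =>
    h d v ε hv hε n θ p hθ (fun k => isOrbitDominant_of_isDominant d v ε (θ k) (p k) (hdom k)) halt

/-- PORT TARGET (method memo §4; pairwise-rule certificate at one code): «T^orb_sym(3,4) ≤ 17 ∀ d»; NOT asserted. [candidate of the cell; no citation exists] -/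
def TSymOrb34Le17 : Prop := TropRootLawAtSymmOrb 3 4 17

/-- PORT TARGET of record (COMBO-BOUND T34-16, two codes, needs the σ-state relaxation): «T^orb_sym(3,4) ≤ 16 ∀ d»; NOT asserted. [candidate of the cell; no citation exists] -/
def TSymOrb34Le16 : Prop := TropRootLawAtSymmOrb 3 4 16

/-! ## Rule R1w (identity orbit at θ₁, transposition orbit at θ₂) as a two-point exchange lemma

The two HYBRID terms: `H₁ = (swap i j, μ on {i,j}, λ elsewhere)` is compared with the identity term at `θ₁`,
`H₂ = (1, λ on {i,j}, μ elsewhere)` with the transposition term at `θ₂`; termwise the exponent sums and the height sums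
of `{D, T}` and `{H₁, H₂}` agree, so `(W D − W H₁)(θ) = −(W T − W H₂)(θ)` is affine in `θ`, positive at `θ₁`, negative at
`θ₂`, hence of negative slope.  Presence of the hybrids is assumed here (it follows from the presence of the letters of
`D` and `T`; routine). Cycle-constancy `μ i = μ j` is NOT needed. -/

/-- affine crossing: the arithmetic core of every pairwise rule. -/
theorem affine_cross {θ₁ θ₂ a a₁ a₂ a₃ c c₁ c₂ c₃ : ℤ} (hθ : θ₁ < θ₂) (ha : a + a₂ = a₁ + a₃)
    (hc : c + c₂ = c₁ + c₃) (h1 : θ₁ * a₁ - c₁ < θ₁ * a - c) (h2 : θ₂ * a₃ - c₃ < θ₂ * a₂ - c₂) : a < a₁ := by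
  have e3 : a₃ = a + a₂ - a₁ := by omega
  have e4 : c₃ = c + c₂ - c₁ := by omega
  subst e3 e4
  by_contra hcon
  push Not at hcon
  have e5 : 0 ≤ (θ₂ - θ₁) * (a - a₁) := mul_nonneg (sub_nonneg.mpr hθ.le) (sub_nonneg.mpr hcon)
  nlinarith [e5]

/-- Rule R1w: identity term `(1, λ)` orbit-dominant at `θ₁`, transposition term `(swap i j, μ)` orbit-dominant at
`θ₂ > θ₁`, hybrids present ⇒ `∑ d(λ) < ∑ d(H₁-letters)`, i.e. `d (λ i) + d (λ j) < d (μ i) + d (μ j)` (= `2·d b` for a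
cycle-constant transposition orbit). -/
theorem rule_R1w (d : Fin K → ℕ) (v ε : Fin m → Fin m → Fin K → ℤ) (θ₁ θ₂ : ℤ) (hθ : θ₁ < θ₂)
    (i j : Fin m) (hij : i ≠ j) (lam μ : Fin m → Fin K)
    (hD : IsOrbitDominant d v ε θ₁ (1, lam)) (hT : IsOrbitDominant d v ε θ₂ (Equiv.swap i j, μ))
    (hH₁ : termSign ε (Equiv.swap i j, fun l => if l = i ∨ l = j then μ l else lam l) ≠ 0)
    (hH₂ : termSign ε ((1 : Equiv.Perm (Fin m)), fun l => if l = i ∨ l = j then lam l else μ l) ≠ 0) :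
    ∑ l, (d (lam l) : ℤ) < ∑ l, (d (if l = i ∨ l = j then μ l else lam l) : ℤ) := by
  have hsw : Equiv.swap i j ≠ (1 : Equiv.Perm (Fin m)) := fun h => hij (Equiv.swap_eq_refl_iff.mp h)
  -- the two comparisons
  have c1 := hD.2 (Equiv.swap i j, fun l => if l = i ∨ l = j then μ l else lam l)
    (fun h => hsw (congrArg Prod.fst h))
    (fun h => hsw (by have := congrArg Prod.fst h; simpa [transposeTerm] using this)) hH₁
  have c2 := hT.2 ((1 : Equiv.Perm (Fin m)), fun l => if l = i ∨ l = j then lam l else μ l)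
    (fun h => hsw (congrArg Prod.fst h).symm)
    (fun h => by
      have h' := congrArg Prod.fst h
      simp only [transposeTerm] at h'
      exact hsw (by rw [← inv_inj, h'.symm, inv_one])) hH₂
  simp only [tropWeight] at c1 c2
  -- termwise bookkeeping identities
  have ha : ∑ l, (d (lam l) : ℤ) + ∑ l, (d (μ l) : ℤ) =
      ∑ l, (d (if l = i ∨ l = j then μ l else lam l) : ℤ) + ∑ l, (d (if l = i ∨ l = j then lam l else μ l) : ℤ) := by
    rw [← Finset.sum_add_distrib, ← Finset.sum_add_distrib]
    refine Finset.sum_congr rfl fun l _ => ?_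
    by_cases h : l = i ∨ l = j <;> simp [h, add_comm]
  have hc : ∑ l, v ((1 : Equiv.Perm (Fin m)) l) l (lam l) + ∑ l, v ((Equiv.swap i j) l) l (μ l) =
      ∑ l, v ((Equiv.swap i j) l) l (if l = i ∨ l = j then μ l else lam l) +
        ∑ l, v ((1 : Equiv.Perm (Fin m)) l) l (if l = i ∨ l = j then lam l else μ l) := by
    rw [← Finset.sum_add_distrib, ← Finset.sum_add_distrib]
    refine Finset.sum_congr rfl fun l _ => ?_
    by_cases h : l = i ∨ l = j
    · simp [h, add_comm]
    · push Not at h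
      simp [h.1, h.2, Equiv.swap_apply_of_ne_of_ne h.1 h.2]
  exact affine_cross hθ ha hc c1 c2

end Summit.ValiantsHypothesis.ValiantsHypothesis.Theorems.LacunarySymmetroidMatrixDescartes.TropicalCensus.Orbit
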